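import Summits.Ventures.PercRepro.Defs
import Summits.Ventures.PercRepro.Conditioning
import Summits.Ventures.PercRepro.FlipConcavity

/-!
# Strict single-flip concavity

The strict form of the principle of `Summits.Ventures.PercRepro.FlipConcavity`: if all edge
probabilities lie in `(0, 1)` and, for some edge `e`, the mixed second difference of `B` along `e`
is strictly negative at some pair `(η, η')` of configurations with `e` closed, then
`E_p[B(ω, ω')] > 0` (`expect2_pos_of_flipConcave`).  By the chord identity,
`E_p[B] ≥ p_e (1 - p_e) · Br_e(p)` with `Br_e(p)` a sum of nonnegative terms, one of which is
`W(η) W(η') · (-Δ_e B(η, η')) > 0`.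
-/

namespace PercRepro

open Finset

variable {E : Type*}

/-! ### The strict chord bound -/

section Strict

variable [Fintype E] [DecidableEq E]

/-- The bracket of the chord identity as a double sum with the weight `p[e := 0]` on both copies. -/
theorem expect2_bracket_eq (p : E → ℝ) (e : E) (B : Config E → Config E → ℝ) :
    expect2 (Function.update p e 1) (Function.update p e 0) B
        + expect2 (Function.update p e 0) (Function.update p e 1) B
        - expect2 (Function.update p e 1) (Function.update p e 1) B
        - expect2 (Function.update p e 0) (Function.update p e 0) B
      = ∑ ω, weight (Function.update p e 0) ω *
          ∑ ω', weight (Function.update p e 0) ω' *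
            (B (Function.update ω e true) (Function.update ω' e false)
              + B (Function.update ω e false) (Function.update ω' e true)
              - B (Function.update ω e true) (Function.update ω' e true)
              - B (Function.update ω e false) (Function.update ω' e false)) := by
  have h11 := expect2_update p e B true true
  have h10 := expect2_update p e B true false
  have h01 := expect2_update p e B false true
  have h00 := expect2_update p e B false false
  simp only [Bool.false_eq_true, ↓reduceIte] at h11 h10 h01 h00
  rw [h11, h10, h01, h00, ← Finset.sum_add_distrib, ← Finset.sum_sub_distrib,
    ← Finset.sum_sub_distrib]
  refine Finset.sum_congr rfl fun ω _ => ?_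
  rw [← mul_add, ← mul_sub, ← mul_sub, ← Finset.sum_add_distrib, ← Finset.sum_sub_distrib,
    ← Finset.sum_sub_distrib]
  congr 1
  refine Finset.sum_congr rfl fun ω' _ => ?_
  ring

/-- With all edge probabilities in `(0, 1)`, the weight of every configuration under `p[e := 0]`
with `e` closed is positive. -/
theorem weight_update_zero_pos {p : E → ℝ} (hp : ∀ e, 0 < p e ∧ p e < 1) (e : E)
    {ω : Config E} (hω : ω e = false) : 0 < weight (Function.update p e 0) ω := by
  rw [weight_update_zero, hω]
  simp only [Bool.false_eq_true, ↓reduceIte]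
  unfold weightErase
  refine Finset.prod_pos fun e' _ => ?_
  split_ifs
  · exact (hp e').1
  · linarith [(hp e').2]

/-- **Strict single-flip concavity.**  Under the hypotheses of `expect2_nonneg_of_flipConcave`,
if all edge probabilities lie in `(0, 1)` and the mixed second difference of `B` along some edge
`e` is strictly negative at some pair `(η, η')` of configurations with `e` closed, then
`E_p[B(ω, ω')] > 0`. -/
theorem expect2_pos_of_flipConcave {p : E → ℝ} (hp : ∀ e, 0 < p e ∧ p e < 1)
    {B : Config E → Config E → ℝ} (hdiag : ∀ ω, 0 ≤ B ω ω)
    (hconc : ∀ e ω ω', B (Function.update ω e true) (Function.update ω' e true)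
        - B (Function.update ω e true) (Function.update ω' e false)
        - B (Function.update ω e false) (Function.update ω' e true)
        + B (Function.update ω e false) (Function.update ω' e false) ≤ 0)
    (e : E) (η η' : Config E) (hη : η e = false) (hη' : η' e = false)
    (hneg : B (Function.update η e true) (Function.update η' e true)
        - B (Function.update η e true) (Function.update η' e false)
        - B (Function.update η e false) (Function.update η' e true)
        + B (Function.update η e false) (Function.update η' e false) < 0) :
    0 < expect2 p p B := by
  have hp' : IsProb p := fun e => ⟨(hp e).1.le, (hp e).2.le⟩
  have h1 := expect2_nonneg_of_flipConcave (hp'.update e ⟨zero_le_one, le_rfl⟩) hdiag hconc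
  have h0 := expect2_nonneg_of_flipConcave (hp'.update e ⟨le_rfl, zero_le_one⟩) hdiag hconc
  have hbr : 0 < expect2 (Function.update p e 1) (Function.update p e 0) B
      + expect2 (Function.update p e 0) (Function.update p e 1) B
      - expect2 (Function.update p e 1) (Function.update p e 1) B
      - expect2 (Function.update p e 0) (Function.update p e 0) B := by
    rw [expect2_bracket_eq]
    have hw : ∀ ω, 0 ≤ weight (Function.update p e 0) ω :=
      weight_nonneg (hp'.update e ⟨le_rfl, zero_le_one⟩)
    have hterm : ∀ ω ω', 0 ≤ B (Function.update ω e true) (Function.update ω' e false)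
        + B (Function.update ω e false) (Function.update ω' e true)
        - B (Function.update ω e true) (Function.update ω' e true)
        - B (Function.update ω e false) (Function.update ω' e false) :=
      fun ω ω' => by linarith [hconc e ω ω']
    have hinner : ∀ ω, 0 ≤ ∑ ω', weight (Function.update p e 0) ω' *
        (B (Function.update ω e true) (Function.update ω' e false)
          + B (Function.update ω e false) (Function.update ω' e true)
          - B (Function.update ω e true) (Function.update ω' e true)
          - B (Function.update ω e false) (Function.update ω' e false)) :=
      fun ω => Finset.sum_nonneg fun ω' _ => mul_nonneg (hw ω') (hterm ω ω')
    refine Finset.sum_pos' (fun ω _ => mul_nonneg (hw ω) (hinner ω)) ⟨η, Finset.mem_univ _, ?_⟩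
    refine mul_pos (weight_update_zero_pos hp e hη) ?_
    refine Finset.sum_pos' (fun ω' _ => mul_nonneg (hw ω') (hterm η ω')) ⟨η', Finset.mem_univ _, ?_⟩
    refine mul_pos (weight_update_zero_pos hp e hη') ?_
    linarith
  rw [expect2_chord p e B]
  have hpe := hp e
  have hq01 : 0 < p e * (1 - p e) := mul_pos hpe.1 (by linarith [hpe.2])
  nlinarith [mul_pos hq01 hbr, mul_nonneg hpe.1.le h1, mul_nonneg (sub_nonneg.2 hpe.2.le) h0]

end Strict

end PercRepro
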